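import Summits.NavierStokesRegularity.NavierStokesRegularity.Theses.PalasekTowerBreakdown
import Summits.NavierStokesRegularity.FluidComputer.PalasekTowerRegisterPushBudget

/-!
# NavierStokesRegularity — route `PalasekTowerBreakdown`: a CEILING VIOLATOR is a self-amplifier —
# the global anchor prices every overshoot of the binders of `AprioriCeiling` / `AprioriCeilingAt k`

Supports `stmt-NavierStokesRegularity-19250` (`PalasekTowerBreakdown.HeredityFromTwo`; upper stub
`AprioriCeiling`, re-typed as «no first overshoot» in `PalasekTowerBreakdownHeredityFromTwoFirstOvershoot.lean`,
p453961) and its sibling 19249 (`AprioriCeilingAt 1`, p454736). Cell `ns-blowup`, seat `ns-palasek-19250-p2`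
(g0; stub-worker — nothing claimed on the route). LABEL: E–C typing (register ARITHMETIC + the stage's own
margin; every statement PROVED; no `Prop`, no named fact). WHAT THIS IS NOT: not NS — no stage, flow or tower is
constructed; nothing here bounds any flow from above after `τ_k`; it says what an overshoot, IF one occurs, has
already done.

## What is proved

The binder class of the upper stubs differs from «any bounded smooth finite-energy flow» only through the
registered HISTORY, which pins neither the energy nor the far field — but it contains the GLOBAL ANCHOR
(`Schedule.AnchorGlobal`, a conjunct of `Margins.routeG`: `‖u‖ < c₁Y₀` on `[0, τ₀) × ℝ³`, everywhere in space).
Hence (`palasekTowerBreakdown_overshoot_anchor_amplification`): for a rigid schedule on the wide rates, any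
field `u` agreeing with a registered level-`k` stage on `[0, τ_k]` that exceeds the next ceiling `c₂Y_{k+1}` at
some `(t, x)` — in particular at every first overshoot of the event form — (i) was `< Y₀` EVERYWHERE on
`[0, τ₀)`, and (ii) now exceeds `(10/3)·2^k·Y₀` (`c₂ = 5/3`, `Y_{k+1} ≥ 2^{k+1}Y₀` by `TowerRates.wide_sep`; the
true ratios `c₂Y_{k+1}/Y₀ = (5/3)(N_{k+1}/256)^{1.3}` are `7.6 / 18 / 47` at `k = 1 / 2 / 3`), while (iii) the
schedule's force after the anchor era is host-small and then silent: `‖f‖ ≤ Y₀` on `[τ₀, τ₁]` with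
`Y₀·(τ₁ − τ₀) ≤ 1/4` (`Schedule.Rigid.push_impulse_le`), `‖f‖ ≤ Y₁` on `[τ₁, τ₂]`, and `f ≡ 0` from `τ₁` on
(`Quiet`) — against `Y₀ ≥ 256` (`TowerRates.wide_Y_ge`). READING (E–C, HEUR beyond the arithmetic): a «far
passenger» violating the ceiling at level `k` is not a dormant structure but an AUTONOMOUS `×(10/3)2^k`
self-amplifier of its own speed maximum from below the anchor within `(τ_{k+1} − τ₀)·Y₀² ≈ 440` Kato units of
the anchor speed — tower-grade dynamics (the planner's FAR-SEED class); the upper stub's real content is the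
tower's OWN hand-over not overshooting, a design property.

References: S. Palasek, arXiv:2605.13827 §3.3–§4 [cite: Palasek2026ElementaryModel, §4].
-/

-- `Summit.<Summit>.<Problem>` is the tree's mandated summit-side namespace (CONVENTIONS §2); for this
-- single-conjunct summit the two coincide, so the duplicate is deliberate.
set_option linter.dupNamespace false

noncomputable section

namespace Summit.NavierStokesRegularity.NavierStokesRegularity.Theorems

open Set MeasureTheory Filter Topology Function Real
open scoped ENNReal ContDiff NNReal
open Literature.Analysis.FluidPDE
open Summit.NavierStokesRegularity.NavierStokesRegularity.Theses
open Summit.NavierStokesRegularity.FluidComputer.PalasekTowerClayBridge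

/-- **The wide rates separate geometrically from the anchor**: `2^k · Y₀ ≤ Y_k` (`TowerRates.wide_sep`
iterated). [folklore] -/
theorem palasekTowerBreakdown_two_pow_mul_Y_zero_le (k : ℕ) :
    2 ^ k * TowerRates.wide.Y 0 ≤ TowerRates.wide.Y k := by
  induction k with
  | zero => simp
  | succ n ih =>
    calc (2 : ℝ) ^ (n + 1) * TowerRates.wide.Y 0 = 2 * (2 ^ n * TowerRates.wide.Y 0) := by ring
      _ ≤ 2 * TowerRates.wide.Y n := by linarith
      _ ≤ TowerRates.wide.Y (n + 1) := TowerRates.wide_sep n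

/-- **The next ceiling in anchor units**: on a rigid schedule on the wide rates
`(10/3)·2^k·(c₁Y₀) ≤ c₂Y_{k+1}` (`c₁ = 1`, `c₂ = 5/3`, `Y_{k+1} ≥ 2^{k+1}Y₀`). [folklore] -/
theorem palasekTowerBreakdown_anchor_le_nextCeiling {S : Schedule TowerRates.wide} (hR : S.Rigid) (k : ℕ) :
    10 / 3 * 2 ^ k * (S.c₁ * TowerRates.wide.Y 0) ≤ S.c₂ * TowerRates.wide.Y (k + 1) := by
  rw [hR.c₁_eq, hR.c₂_eq, one_mul]
  have h := palasekTowerBreakdown_two_pow_mul_Y_zero_le (k + 1)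
  calc (10 : ℝ) / 3 * 2 ^ k * TowerRates.wide.Y 0 = 5 / 3 * (2 ^ (k + 1) * TowerRates.wide.Y 0) := by
        ring
    _ ≤ 5 / 3 * TowerRates.wide.Y (k + 1) := by linarith

/-- **A CEILING VIOLATOR IS A SELF-AMPLIFIER (the global anchor prices every overshoot).** Rigid
schedule on the wide rates, registered (globally anchored) stage `s` at ANY level `k`, any field `u` agreeing
with `s` in velocity on `[0, τ_k]` (the continuations of `AprioriCeiling` / `AprioriCeilingAt k` /
`ReadoutFloors…`), any point `(t, x)` where `u` exceeds the next ceiling `c₂Y_{k+1}`: then (i) `‖u‖ < c₁Y₀`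
everywhere on `[0, τ₀) × ℝ³` (the stage's global anchor, inherited by agreement), (ii)
`‖u(t, x)‖ > (10/3)·2^k·(c₁Y₀)`, and (iii) after the anchor era the design force is host-small then silent:
`‖f‖ ≤ c₁Y₀` on `[τ₀, τ₁] × ℝ³` with `c₁Y₀·(τ₁ − τ₀) ≤ 1/4`, and — if the schedule is quiet — `f(t') = 0`
for `t' ≥ τ₁`; and `c₁Y₀ ≥ 256`. Register arithmetic + the margin; no dynamics. [cite: Palasek2026ElementaryModel, §4] -/
theorem palasekTowerBreakdown_overshoot_anchor_amplification {S : Schedule TowerRates.wide}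
    (hR : S.Rigid) {k : ℕ} (s : Stage 1 TowerRates.wide S (Margins.routeG TowerRates.wide) k)
    {u : ℝ → EuclideanSpace ℝ (Fin 3) → EuclideanSpace ℝ (Fin 3)}
    (hagree : ∀ t ∈ Icc 0 (S.τ k), u t = s.u t) {t : ℝ} {x : EuclideanSpace ℝ (Fin 3)}
    (hgt : S.c₂ * TowerRates.wide.Y (k + 1) < ‖u t x‖) :
    (∀ t' ∈ Ico 0 (S.τ 0), ∀ y, ‖u t' y‖ < S.c₁ * TowerRates.wide.Y 0) ∧
      10 / 3 * 2 ^ k * (S.c₁ * TowerRates.wide.Y 0) < ‖u t x‖ ∧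
      (∀ t' ∈ Icc (S.τ 0) (S.τ (0 + 1)), ∀ y, ‖S.f t' y‖ ≤ S.c₁ * TowerRates.wide.Y 0) ∧
      S.c₁ * TowerRates.wide.Y 0 * (S.τ (0 + 1) - S.τ 0) ≤ 1 / 4 ∧
      (S.Quiet → ∀ t', S.τ 1 ≤ t' → S.f t' = 0) ∧
      (256 : ℝ) ≤ S.c₁ * TowerRates.wide.Y 0 := by
  refine ⟨fun t' ht' y => ?_, lt_of_le_of_lt (palasekTowerBreakdown_anchor_le_nextCeiling hR k) hgt,
    fun t' ht' y => ?_, ?_, fun hQ t' ht' => hQ t' ht', ?_⟩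
  · -- (i) the global anchor of the stage, inherited on `[0, τ₀) ⊆ [0, τ_k]`
    rw [hagree t' ⟨ht'.1, ht'.2.le.trans (S.τ_mono (Nat.zero_le k))⟩]
    exact s.routeG_anchorGlobal t' ht' y
  · -- (iii) host-small push on window `0`: `‖f‖ ≤ c₄Y₀ ≤ c₁Y₀`
    have hY : 0 < TowerRates.wide.Y 0 := Real.rpow_pos_of_pos (TowerRates.wide.N_pos 0) _
    exact (S.push_small 0 t' ht' y).trans (mul_le_mul_of_nonneg_right S.c₄_le hY.le)
  · -- the push budget of window `0`
    have h := hR.push_impulse_le (c := S.c₁) (by rw [hR.c₁_eq]) 0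
    simpa [mul_assoc] using h
  · rw [hR.c₁_eq, one_mul]
    exact TowerRates.wide_Y_ge 0

/-- **The same at a first overshoot of the event form** (the shape in which the upper stubs were re-typed,
p453961 / p454736): a first overshoot of a level `L > c₂Y_{k+1}` at `(t₀, x₀)` by a field agreeing with a
registered stage on `[0, τ_k]` has `‖u‖ < c₁Y₀` on `[0, τ₀) × ℝ³` and `L > (10/3)·2^k·(c₁Y₀)` — the flow
multiplied its own global speed maximum by more than `(10/3)·2^k` between the anchor era and `t₀`.
[cite: Palasek2026ElementaryModel, §4] -/
theorem palasekTowerBreakdown_firstOvershoot_anchor_amplification {S : Schedule TowerRates.wide}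
    (hR : S.Rigid) {k : ℕ} (s : Stage 1 TowerRates.wide S (Margins.routeG TowerRates.wide) k)
    {u : ℝ → EuclideanSpace ℝ (Fin 3) → EuclideanSpace ℝ (Fin 3)}
    (hagree : ∀ t ∈ Icc 0 (S.τ k), u t = s.u t) {L t₀ : ℝ} {x₀ : EuclideanSpace ℝ (Fin 3)}
    (hL : S.c₂ * TowerRates.wide.Y (k + 1) < L) (heq : ‖u t₀ x₀‖ = L) :
    (∀ t' ∈ Ico 0 (S.τ 0), ∀ y, ‖u t' y‖ < S.c₁ * TowerRates.wide.Y 0) ∧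
      10 / 3 * 2 ^ k * (S.c₁ * TowerRates.wide.Y 0) < L := by
  have h := palasekTowerBreakdown_overshoot_anchor_amplification hR s hagree (t := t₀) (x := x₀)
    (by rw [heq]; exact hL)
  exact ⟨h.1, by rw [← heq]; exact h.2.1⟩

end Summit.NavierStokesRegularity.NavierStokesRegularity.Theorems

end
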